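import Summits.ResolutionOfSingularities.ResolutionOfSingularities.Theorems.UniformComplexityCampaignW82TwistNormalAlgebra
import Summits.ResolutionOfSingularities.ResolutionOfSingularities.Theorems.UniformComplexityCampaignW82TwistExponentNormalization
import HarnessLib

/-!
# [OURS · L1 W8.2] `F[u,y,z]/(u^p − yz)` (characteristic `p`): a NORMAL domain, NOT regular at the origin

Cell `res-hironaka` (run/shared/lean/pub/res-hironaka/), LADDER-RESOLUTION rung L (RESCUE), slot W8.2 of
plan/RESCUE-SEED.md, door 2 = route `UniformComplexity`, host item `PrimeModelTransfer`
(stmt-ResolutionOfSingularities-8933); prover res-L1-s82-pv-2 (gen 4). THESES-FREE algebra module (imports the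
gen-4 sibling `…TwistNormalAlgebra` (`ApRing`, `toPlane`, `toPlane_injective`, `euler`, `euler_toPlane`,
`mem_range_toPlane_of_euler_eq_zero`, `isIntegrallyClosed_of_derivation`), the gen-3 sibling
`…TwistExponentNormalization` (only the bookkeeping lemma `TwistExponent.comap_map_mk_eq_of_le'` and, through it,
the Literature file `Resolution.RegularLocalRingsJacobian`: `not_isRegularLocalRing_localization_of_pderiv_eval_eq_zero`),
`HarnessLib`). Consumed by Theorems/UniformComplexityCampaignW82TwistNormal.lean.

[OURS · L1 W8.2] support lemmas; replace the role of no printed item; NOT statements of H. Hironaka's manuscript.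
The algebra of near-miss (s2) of Cruxes/PrimeFieldToPerfect/Disproof.lean (`twistedSurface_normal_not_regular`,
there for `u^p + y² + z²`, `p` odd, left `sorry` for want of normality) = strategist census N3, in the split form
`u^p − yz`, EVERY prime `p`, every field `F` of characteristic `p`:

* §5 `apPoly F p = X₀^p − X₁X₂`, `ApQuot F p = F[X₀,X₁,X₂]/(apPoly)`; `quotEquiv : ApQuot ≃+* ApRing` through
  `F[X₀,X₁,X₂] ≅ F[X₁,X₂][X₀]` (`finSuccEquiv_apPoly`); `toSurface = toPlane ∘ quotEquiv : ApQuot → F[a,b]`,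
  `u ↦ ab`, `y ↦ a^p`, `z ↦ b^p` (`toSurface_mk`), injective (`toSurface_injective`); hence
  `isDomain_apQuot`, **`isIntegrallyClosed_apQuot`** (NORMAL: constants of `a∂_a − b∂_b`), and
  **`not_isRegularLocalRing_origin`** / `not_isRegularRing_apQuot` (NOT regular at `origin = (u,y,z)/(f)`:
  `f ≠ 0`, `f(0) = 0`, `∂f/∂u = pu^{p−1}`, `∂f/∂y = −z`, `∂f/∂z = −y` all vanish at `0`; the tree's Jacobian
  criterion). So `Spec F[u,y,z]/(u^p − yz)` IS ITS OWN NORMALISATION AND IS SINGULAR.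

HONEST FRAMING. OURS support; classical mathematics (the `A_{p−1}` point); nothing here is a statement of
H. Hironaka's manuscript [Hironaka2017], nothing attributed to its author. No `sorry`, no new axioms. AI work,
weaker than expert review.

## References (locators only)
* N. Shepherd-Barron, arXiv:1711.10439, Remark 2(1). Zs. Patakfalvi–J. Waldron, arXiv:1708.04268, §2.4.
* R. Hartshorne, *Algebraic Geometry* (1977), I Thm. 5.1; H. Matsumura, *Commutative Ring Theory*, Thm. 14.2.
-/

noncomputable section

set_option linter.dupNamespace false -- mandated namespace of this single-conjunct summit

open Polynomial IsLocalRing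

namespace Summit.ResolutionOfSingularities.ResolutionOfSingularities.Theorems.CampaignW82.TwistNormal

section ApQuot

variable (F : Type) [Field F] (p : ℕ)

/-! ## §5 The hypersurface presentation `F[u,y,z]/(u^p − yz)`: domain, NORMAL, NOT regular at the origin -/

/-- `f = X₀^p − X₁X₂ ∈ F[X₀,X₁,X₂]` (`X₀ = u`, `X₁ = y`, `X₂ = z`). [folklore] -/
def apPoly : MvPolynomial (Fin 3) F := MvPolynomial.X 0 ^ p - MvPolynomial.X 1 * MvPolynomial.X 2

/-- The `A_{p−1}` ring in its hypersurface presentation `F[u,y,z]/(u^p − yz)`. [folklore] -/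
abbrev ApQuot : Type := MvPolynomial (Fin 3) F ⧸ Ideal.span {apPoly F p}

/-- Under `F[X₀,X₁,X₂] ≅ F[X₁,X₂][X₀]`, `f ↦ g`. [folklore] -/
theorem finSuccEquiv_apPoly : MvPolynomial.finSuccEquiv F 2 (apPoly F p) = gPolyAp F p := by
  have h1 : MvPolynomial.finSuccEquiv F 2 (MvPolynomial.X 1) = C (MvPolynomial.X 0) :=
    MvPolynomial.finSuccEquiv_X_succ (j := 0)
  have h2 : MvPolynomial.finSuccEquiv F 2 (MvPolynomial.X 2) = C (MvPolynomial.X 1) :=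
    MvPolynomial.finSuccEquiv_X_succ (j := 1)
  rw [apPoly, gPolyAp, map_sub, map_pow, map_mul, MvPolynomial.finSuccEquiv_X_zero, h1, h2, ← map_mul]

/-- `F[u,y,z]/(f) ≅ F[y,z][u]/(g)`. [folklore] -/
def quotEquiv : ApQuot F p ≃+* ApRing F p :=
  Ideal.quotientEquiv (Ideal.span {apPoly F p}) (Ideal.span {gPolyAp F p})
    (MvPolynomial.finSuccEquiv F 2).toRingEquiv (by
      rw [Ideal.map_span, Set.image_singleton]
      exact congrArg _ (congrArg _ (finSuccEquiv_apPoly F p).symm))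

/-- **The embedding `F[u,y,z]/(u^p − yz) → F[a,b]`, `u ↦ ab`, `y ↦ a^p`, `z ↦ b^p`.** [folklore] -/
def toSurface : ApQuot F p →+* MvPolynomial (Fin 2) F := (toPlane F p).comp (quotEquiv F p).toRingHom

/-- `toSurface` on a representative, through `F[X₁,X₂][X₀]`. [folklore] -/
theorem toSurface_mk_eq (h : MvPolynomial (Fin 3) F) :
    toSurface F p (Ideal.Quotient.mk _ h) =
      (MvPolynomial.finSuccEquiv F 2 h).eval₂ (MvPolynomial.expand p).toRingHom
        (MvPolynomial.X 0 * MvPolynomial.X 1) := by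
  rw [← toPlane_mk]; rfl

/-- `toSurface ∘ mk` is the substitution `u ↦ ab`, `y ↦ a^p`, `z ↦ b^p`. [folklore] -/
theorem toSurface_comp_mk : (toSurface F p).comp (Ideal.Quotient.mk _) =
    (MvPolynomial.aeval ![MvPolynomial.X 0 * MvPolynomial.X 1, MvPolynomial.X 0 ^ p, MvPolynomial.X 1 ^ p] :
      MvPolynomial (Fin 3) F →ₐ[F] MvPolynomial (Fin 2) F).toRingHom := by
  refine MvPolynomial.ringHom_ext (fun c => ?_) (fun i => ?_)
  · rw [RingHom.comp_apply, toSurface_mk_eq]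
    show _ = MvPolynomial.aeval _ (MvPolynomial.C c)
    rw [MvPolynomial.algHom_C, MvPolynomial.algebraMap_eq]
    have hC : MvPolynomial.finSuccEquiv F 2 (MvPolynomial.C c) = C (MvPolynomial.C c) := by
      rw [MvPolynomial.finSuccEquiv_apply]; simp
    rw [hC, eval₂_C, AlgHom.toRingHom_eq_coe, RingHom.coe_coe, MvPolynomial.expand_C]
  · rw [RingHom.comp_apply, toSurface_mk_eq]
    show _ = MvPolynomial.aeval _ (MvPolynomial.X i)
    rw [MvPolynomial.aeval_X]
    fin_cases i
    · show (MvPolynomial.finSuccEquiv F 2 (MvPolynomial.X 0)).eval₂ _ _ = _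
      rw [MvPolynomial.finSuccEquiv_X_zero, eval₂_X]; rfl
    · show (MvPolynomial.finSuccEquiv F 2 (MvPolynomial.X (Fin.succ 0))).eval₂ _ _ = _
      rw [MvPolynomial.finSuccEquiv_X_succ, eval₂_C, AlgHom.toRingHom_eq_coe, RingHom.coe_coe,
        MvPolynomial.expand_X]; rfl
    · show (MvPolynomial.finSuccEquiv F 2 (MvPolynomial.X (Fin.succ 1))).eval₂ _ _ = _
      rw [MvPolynomial.finSuccEquiv_X_succ, eval₂_C, AlgHom.toRingHom_eq_coe, RingHom.coe_coe,
        MvPolynomial.expand_X]; rfl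

/-- `toSurface` on a representative. [folklore] -/
theorem toSurface_mk (h : MvPolynomial (Fin 3) F) : toSurface F p (Ideal.Quotient.mk _ h) =
    MvPolynomial.aeval ![MvPolynomial.X 0 * MvPolynomial.X 1, MvPolynomial.X 0 ^ p, MvPolynomial.X 1 ^ p] h := by
  have := congrArg (fun φ : MvPolynomial (Fin 3) F →+* MvPolynomial (Fin 2) F => φ h) (toSurface_comp_mk F p)
  simpa using this

/-- **`toSurface` is injective** (`toPlane_injective` through `quotEquiv`). [folklore] -/
theorem toSurface_injective [Fact p.Prime] : Function.Injective (toSurface F p) :=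
  (toPlane_injective F p).comp (quotEquiv F p).injective

/-- The range of `toSurface` is that of `toPlane`. [folklore] -/
theorem range_toSurface : (toSurface F p).range = (toPlane F p).range := by
  ext b
  constructor
  · rintro ⟨w, rfl⟩; exact ⟨_, rfl⟩
  · rintro ⟨w, rfl⟩; exact ⟨(quotEquiv F p).symm w, by simp [toSurface]⟩

/-- **`F[u,y,z]/(u^p − yz)` is a domain** (a subring of `F[a,b]`). [folklore] -/
theorem isDomain_apQuot [Fact p.Prime] : IsDomain (ApQuot F p) :=
  (toSurface_injective F p).isDomain (toSurface F p)

/-- **`F[u,y,z]/(u^p − yz)` is a NORMAL domain in characteristic `p`** (`isIntegrallyClosed_of_derivation`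
with the Euler-type derivation `a∂_a − b∂_b` of the integrally closed `F[a,b]`). [folklore] -/
theorem isIntegrallyClosed_apQuot [Fact p.Prime] [CharP F p] : IsIntegrallyClosed (ApQuot F p) := by
  haveI := isDomain_apQuot F p
  refine isIntegrallyClosed_of_derivation (toSurface F p) (toSurface_injective F p) (euler F)
    (fun r => ?_) (fun b hb => ?_)
  · exact euler_toPlane F p (quotEquiv F p r)
  · rw [range_toSurface]; exact mem_range_toPlane_of_euler_eq_zero F p b hb

/-- `f ≠ 0` (it takes the value `1` at `(1,0,0)`). [folklore] -/
theorem apPoly_ne_zero : apPoly F p ≠ 0 := by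
  intro h
  have := congrArg (MvPolynomial.eval ![(1 : F), 0, 0]) h
  simp [apPoly] at this

/-- `f(0) = 0`. [folklore] -/
theorem eval_zero_apPoly (hp0 : p ≠ 0) : MvPolynomial.eval (0 : Fin 3 → F) (apPoly F p) = 0 := by
  simp [apPoly, hp0]

/-- All partials of `f` vanish at the origin (`p ≥ 2`; `∂f/∂u = pu^{p−1}`, `∂f/∂y = −z`, `∂f/∂z = −y`).
[folklore] -/
theorem eval_zero_pderiv_apPoly [hp : Fact p.Prime] (i : Fin 3) :
    MvPolynomial.eval (0 : Fin 3 → F) (MvPolynomial.pderiv i (apPoly F p)) = 0 := by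
  have h2 : p - 1 ≠ 0 := by have := hp.out.two_le; omega
  fin_cases i <;>
    simp [apPoly, Derivation.leibniz_pow, h2]

/-- The origin `𝔭₀ = (u,y,z)/(f)` of `Spec F[u,y,z]/(u^p − yz)`. [folklore] -/
def origin : Ideal (ApQuot F p) :=
  (RingHom.ker (MvPolynomial.eval (0 : Fin 3 → F))).map (Ideal.Quotient.mk (Ideal.span {apPoly F p}))

/-- `(f) ≤ ker (eval 0)`. [folklore] -/
theorem span_apPoly_le_ker (hp0 : p ≠ 0) :
    Ideal.span {apPoly F p} ≤ RingHom.ker (MvPolynomial.eval (0 : Fin 3 → F)) := by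
  rw [Ideal.span_le, Set.singleton_subset_iff]; exact eval_zero_apPoly F p hp0

/-- The origin is a prime ideal. [folklore] -/
theorem origin_isPrime (hp0 : p ≠ 0) : (origin F p).IsPrime :=
  haveI := RingHom.ker_isPrime (MvPolynomial.eval (0 : Fin 3 → F))
  Ideal.map_isPrime_of_surjective Ideal.Quotient.mk_surjective
    (by rw [Ideal.mk_ker]; exact span_apPoly_le_ker F p hp0)

/-- **The origin is a NON-REGULAR point of `F[u,y,z]/(u^p − yz)`** (tree Jacobian criterion, singular
direction: `f ≠ 0`, `f(0) = 0`, all partials vanish at `0`). [folklore] -/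
theorem not_isRegularLocalRing_origin [hp : Fact p.Prime] :
    haveI := origin_isPrime F p hp.out.ne_zero
    ¬ IsRegularLocalRing (Localization.AtPrime (origin F p)) := by
  haveI := origin_isPrime F p hp.out.ne_zero
  exact Literature.AlgebraicGeometry.Resolution.not_isRegularLocalRing_localization_of_pderiv_eval_eq_zero
    (0 : Fin 3 → F) (apPoly_ne_zero F p) (eval_zero_apPoly F p hp.out.ne_zero)
    (eval_zero_pderiv_apPoly F p) (origin F p)
    (TwistExponent.comap_map_mk_eq_of_le' _ _ (span_apPoly_le_ker F p hp.out.ne_zero))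

/-- **`F[u,y,z]/(u^p − yz)` is NOT a regular ring.** [folklore] -/
theorem not_isRegularRing_apQuot [hp : Fact p.Prime] : ¬ IsRegularRing (ApQuot F p) := by
  intro h
  haveI := origin_isPrime F p hp.out.ne_zero
  exact not_isRegularLocalRing_origin F p (IsRegularRing.isRegularLocalRing_localization (origin F p))

end ApQuot

end Summit.ResolutionOfSingularities.ResolutionOfSingularities.Theorems.CampaignW82.TwistNormal

end
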